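import Literature.IUT.HodgeArakelov.PlusMinusTowerDef23iIndicesOfComap
import Literature.IUT.HodgeArakelov.StableCurveAgreementOfSpecialFibre
import Literature.AnabelianGeometry.EtaleTheta.LDeltaThetaIndex
import HarnessLib

/-!
# [IUTchII] Rmk 2.1.1 (ii) «totally ramified at the cusps» FROM [EtTh]: `g I_x g⁻¹ ⊄ Π^tp_{X̲̲}`, and the ramification input of Def 2.3 (i)'s indices at the genuine datum

S. Mochizuki, *Inter-universal Teichmüller Theory II*, kurims manuscript (Dec. 2020), §2, Rmk 2.1.1 (ii) p. 65 («the degree `l` covering … is totally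
ramified at the cusps»), Def 2.3 (i) p. 67 («`Π^±_{v▶}/Π_{v▶} ⥲ Π^±_v/Π_v … (≅ ℤ/lℤ)`») [cite: Mochizuki2012, II Rmk 2.1.1 (ii) p.65, II Def 2.3 (i) p.67]
(D-0012 claim key, status disputed; nothing of the series is asserted); S. Mochizuki, *The étale theta function …*, Publ. RIMS **45** (2009) [EtTh], §1
p. 12 («`Δ_Θ (≅ Ẑ(1))`»), §2 p. 35 («`D_x → Π^Θ_X` … maps the inertia group `I_x ⊆ D_x` isomorphically onto `Δ_Θ`»; `Δ̄_Θ ≅ (ℤ/lℤ)(1)`), Prop 2.2 (ii)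
p. 37 / Prop 2.12 (i) p. 45 («`Δ_X̲̲` … meets `Δ_Θ` in `l·Δ_Θ`») [cite: MochizukiEtTh2009, §2 p.35, Prop 2.12 (i) p.45].  abc-iut cell, seat abc-iut-w5-d132
(gen 5); node **IUTchII:Def2.3(i)** (sequel to this seat's `PlusMinusTowerDef23iIndicesOfComap`, p439385: its INLINE ramification hypothesis
«`φ⁻¹ I_x ⊄ incl Π_v`» DERIVED from [EtTh]-level inputs at the genuine datum).  PROOF-ONLY (no `def`/`structure`/`instance`).

THE POINT.  p439385 proves clause (2) «`[Π^±_{v▶} : Π_{v▶}] = l`» of abc-iut-L6-t1's `Def23_i_indices` from «`Π^tp_{X̲_v,ℍ} ⊄ Π_v`», itself from a cusp meeting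
`ℍ` at which `X̲̲_v → X̲_v` is RAMIFIED (inline hypothesis).  Here that ramification is a THEOREM of the [EtTh] typings: for abc-iut-L2-t7's
`DoubleUnderline` datum `C` (`Π^tp_{X̲̲} = C.Huu`, field `map_toTheta_Huu : toTheta(Π^tp_{X̲̲}) ∩ Δ_Θ = l·Δ_Θ`), a cusp `x` of `X` whose inertia maps ONTO `Δ_Θ`
(`hx : toTheta(I_x) = Δ_Θ` — [EtTh] §2 p. 35; the registered v-next §1 clause, G-L2t10-3 family, DISCHARGED from the commutator-axis clause by
abc-iut-w5-d165's `map_toTheta_inertia_eq_deltaTheta_of_commutatorAxis`) and a cyclotome datum `μ₁ : CyclotomeMod 1 l` (`[Δ_Θ : l·Δ_Θ] = l`,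
abc-iut-L2 `index_lDeltaTheta_of_cyclotomeMod`): **no conjugate `g I_x g⁻¹` lies in `Π^tp_{X̲̲}`** (its image in `(Π^tp_X)^Θ` is the normal subgroup `Δ_Θ`,
which is not inside `l·Δ_Θ` when `l > 1`).  Read at abc-iut-L5's datum `ofSpecialFibre` of `X̲_v = ofOpenSubgroup X (GtpXu l) …` (abc-iut-L6-t7, B15
piece 1; cusp inertia `I_y = Π^tp_{X̲} ∩ g I_x g⁻¹`) through abc-iut-L6-t19's `plainIso` of a Prop 2.1 output over `BadPlaceSetting.ofUnderline`:
**`φ⁻¹ I_y ⊄ incl Π_v`** — the `hram` input of p439385's `not_comap_piTpXH_le_of_ramified_cusp`.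

* `DoubleUnderline.not_map_conj_inertia_le_Huu` — [EtTh] level: `g I_x g⁻¹ ⊄ Π^tp_{X̲̲}` (from `hx`, `μ₁`, `1 < l`);
* `TemperedCoverings.map_plainIso_range_incl` — `plainIso(incl Π_v) = inclPlain(Π_v)` (abc-iut-L6-t19's `plainIso_incl`);
* **`PlusMinusTower.not_comap_inertiaTp_le_range_incl_ofUnderline`** — the ramification input `hram` at the genuine datum of `X̲_v`, for EVERY cusp `y`
  of `X̲_v`, from `hx` at the underlying cusp of `X`, `μ₁`, and `I_x ⊆ Π^tp_{X̲}` (⟸ (P3) «`D_x ⊆ Π^tp_Y`», `GtpY_le_GtpXu`);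
* **`PlusMinusTower.not_comap_piTpXH_le_range_incl_ofUnderline`** — hence «`plainIso⁻¹ Π^tp_{X̲_v,ℍ} ⊄ incl Π_v`» for every sub-graph `ℍ` meeting a cusp
  ([IUTchI] Cor 2.3 (vi) of the datum BY NAME) — the `hnot` input of p439385's `def23_i_indices_ofUnderline_of_comap`.

HONEST LABEL: kernel theorems; the [EtTh] clause `hx`, the cyclotome `μ₁`, (P3), Cor 2.3 (vi) and the special-fibre DATA are named inputs; nothing of
[EtTh] or of the series is asserted beyond the tree's typings; no side taken on [IUTchIII] Cor 3.12.
-/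

noncomputable section

/-! ### [EtTh] level -/

namespace Literature.AnabelianGeometry.EtaleTheta.ThetaSetting.EtaleThetaData.DoubleUnderline

open scoped Pointwise

variable {p : ℕ} [Fact p.Prime] {D : Literature.AnabelianGeometry.EtaleTheta.ThetaSetting p}
  {E : D.EtaleThetaData} {l : ℕ} (C : E.DoubleUnderline l)

/-- **«`X̲̲ → X̲` is ramified at the cusps» from [EtTh]**: if the inertia group `I_x` of a cusp of `X` maps onto `Δ_Θ` in `(Π^tp_X)^Θ` ([EtTh] §2 p. 35,
`hx`) and `[Δ_Θ : l·Δ_Θ] = l > 1` (cyclotome `μ₁`), then NO conjugate `g I_x g⁻¹` (`g ∈ Π^tp_X`) lies in `Π^tp_{X̲̲} = C.Huu` — since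
`toTheta(Π^tp_{X̲̲}) ∩ Δ_Θ = l·Δ_Θ` (field `map_toTheta_Huu`) while `toTheta(g I_x g⁻¹) = Δ_Θ` (`Δ_Θ` is normal).  PROVED.
[cite: MochizukiEtTh2009, §2 p.35, Prop 2.12 (i) p.45] -/
theorem not_map_conj_inertia_le_Huu (x : D.Pt) (hx : (D.inertia x).map D.toTheta = D.DeltaTheta) (g : D.PiTemp)
    {lpos : ℕ+} (hlpos : (lpos : ℕ) = l) (μ₁ : D.CyclotomeMod 1 lpos) (hl1 : 1 < l) :
    ¬ (D.inertia x).map (MulAut.conj g).toMonoidHom ≤ C.Huu := by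
  intro hle
  -- image in the theta quotient: `toTheta(g I_x g⁻¹) = toTheta(g) Δ_Θ toTheta(g)⁻¹ = Δ_Θ`
  have hcomp : D.toTheta.comp (MulAut.conj g).toMonoidHom = (MulAut.conj (D.toTheta g)).toMonoidHom.comp D.toTheta := by
    ext y
    simp [map_mul, map_inv]
  have h1 : ((D.inertia x).map (MulAut.conj g).toMonoidHom).map D.toTheta = D.DeltaTheta := by
    rw [Subgroup.map_map, hcomp, ← Subgroup.map_map, hx]
    haveI : D.DeltaTheta.Normal := by unfold ThetaSetting.DeltaTheta; infer_instance
    exact Subgroup.Normal.conj_smul_eq_self (D.toTheta g) D.DeltaTheta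
  have h2 : D.DeltaTheta ≤ C.Huu.map D.toTheta ⊓ D.DeltaTheta := le_inf (h1 ▸ Subgroup.map_mono hle) le_rfl
  rw [C.map_toTheta_Huu] at h2
  -- so `l·Δ_Θ = Δ_Θ`, contradicting `[Δ_Θ : l·Δ_Θ] = l > 1`
  have h3 : (D.lDeltaTheta l).subgroupOf D.DeltaTheta = ⊤ := by
    rw [eq_top_iff]
    intro y _
    exact Subgroup.mem_subgroupOf.mpr (h2 y.2)
  have h4 := D.index_lDeltaTheta_of_cyclotomeMod μ₁
  rw [hlpos] at h4
  rw [h3, Subgroup.index_top] at h4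
  omega

end Literature.AnabelianGeometry.EtaleTheta.ThetaSetting.EtaleThetaData.DoubleUnderline

namespace Literature.IUT.HodgeArakelov

open Literature.AnabelianGeometry.EtaleTheta Literature.AnabelianGeometry.SemiGraphs Literature.IUT.HodgeTheaters
open scoped Pointwise

/-! ### `plainIso(incl Π_v) = inclPlain(Π_v)` -/

namespace TemperedCoverings

universe u

variable {S : BadPlaceSetting.{u}} {P : TopGroup.{u}} (T : TemperedCoverings S P)

/-- **IUTchII:Prop2.1** (kurims p.65) `plainIso` carries `incl(P)` onto the reference vertical arrow's image `inclPlain(Π_v)` (abc-iut-L6-t19's `plainIso_incl`,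
`refIso` surjective).  PROVED. [claim: Mochizuki2012, status: disputed] -/
theorem map_plainIso_range_incl : T.incl.range.map T.plainIso.toMulEquiv.toMonoidHom = S.inclPlain.range := by
  ext y
  constructor
  · rintro ⟨_, ⟨x, rfl⟩, rfl⟩
    exact ⟨T.refIso x, (T.plainIso_incl x).symm⟩
  · rintro ⟨z, rfl⟩
    obtain ⟨x, rfl⟩ := T.refIso.surjective z
    exact ⟨T.incl x, ⟨x, rfl⟩, T.plainIso_incl x⟩

end TemperedCoverings

/-! ### At the genuine datum of `X̲_v` over `BadPlaceSetting.ofUnderline` -/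

namespace PlusMinusTower

variable {p : ℕ} [Fact p.Prime] {M : MuTwoSetting p}
  {E : M.toThetaSetting.EtaleThetaData} {l : ℕ} (C : E.DoubleUnderline l) {N : ℕ+}
  (μ : M.toThetaSetting.CyclotomeMod l N) (hC : M.toThetaSetting.Compat) (hS : M.toThetaSetting.Sec2Hyps)
  (hl : l.Prime) (hp2 : p ≠ 2) (hpl : p ≠ l) (hζ : ∃ ζ : M.toThetaSetting.K, IsPrimitiveRoot ζ (4 * l))
  {η : (C.thetaEnvData μ hC hS).PiYdd → MuN p N} (hη : η ∈ (C.thetaEnvData μ hC hS).thetaCocycles)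
  {P : TopGroup.{0}} (T : TemperedCoverings (BadPlaceSetting.ofUnderline C μ hC hS hl hp2 hpl hζ hη) P)

/-- **IUTchII:Rmk2.1.1(ii)** (kurims p.65) **The ramification input `hram` at the GENUINE datum of `X̲_v`.**  For abc-iut-L5's datum `ofSpecialFibre` of
`X̲_v = ofOpenSubgroup X (GtpXu l) …` (cusps `y` over the cusps `x` of `X`, `I_y = Π^tp_{X̲} ∩ g I_x g⁻¹`) and abc-iut-L6-t19's `plainIso` of a Prop 2.1 output
`T` over `BadPlaceSetting.ofUnderline`: `plainIso⁻¹(I_y) ⊄ incl(Π_v)` — from the [EtTh] clause `hx : toTheta(I_x) = Δ_Θ` at the underlying cusp, a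
cyclotome `μ₁` at level `(1, l)`, and `I_x ⊆ Π^tp_{X̲}` (`hIx`; ⟸ (P3)).  PROVED (`DoubleUnderline.not_map_conj_inertia_le_Huu`). [claim: Mochizuki2012, status: disputed] -/
theorem not_comap_inertiaTp_le_range_incl_ofUnderline [(M.GtpXu l).FiniteIndex] [FiniteDimensional ℚ_[p] M.K]
    (hDopen : ∀ (x : M.toTemperedCurve.Pt) (g : M.toTemperedCurve.PiTemp),
      IsOpen (M.toTemperedCurve.aug '' ((M.toTemperedCurve.decompOfOpenAt (M.GtpXu l) x g).map (M.GtpXu l).subtype :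
        Set M.toTemperedCurve.PiTemp)))
    (d : (M.toTemperedCurve.ofOpenSubgroup (M.GtpXu l) (M.toThetaSetting.isOpen_GtpXu l) M.K (range_aug_GtpXu_eq_GK C) hDopen).GroupLevelData)
    (Sf : SpecialFibreData ((M.toTemperedCurve.ofOpenSubgroup (M.GtpXu l) (M.toThetaSetting.isOpen_GtpXu l) M.K (range_aug_GtpXu_eq_GK C) hDopen).toTemperedArithmeticGroup d))
    (h36 : Sf.Gc.Prop36Hypotheses) (Sigma SigmaHat : Set ℕ) (hsub : Sigma ⊆ SigmaHat) (hne : Sigma.Nonempty)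
    (hprime : ∀ q ∈ SigmaHat, q.Prime) (hp : p ∉ Sigma) (TpH : Subgroup Sf.chart.G)
    (HatH : Subgroup (TemperedGraphGroupData.exists_completion_of_prop36 Sf.Gc h36 Sf.chart).choose)
    (hle : TpH.map (TemperedGraphGroupData.exists_completion_of_prop36 Sf.Gc h36 Sf.chart).choose_spec.choose.toMonoidHom ≤ HatH)
    (cuspMeetsH : {x : (M.toTemperedCurve.ofOpenSubgroup (M.GtpXu l) (M.toThetaSetting.isOpen_GtpXu l) M.K (range_aug_GtpXu_eq_GK C) hDopen).Pt // (M.toTemperedCurve.ofOpenSubgroup (M.GtpXu l) (M.toThetaSetting.isOpen_GtpXu l) M.K (range_aug_GtpXu_eq_GK C) hDopen).IsCusp x} → Prop)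
    (y : (StableCurveTemperedData.ofSpecialFibre (M.toTemperedCurve.ofOpenSubgroup (M.GtpXu l) (M.toThetaSetting.isOpen_GtpXu l) M.K (range_aug_GtpXu_eq_GK C) hDopen) d Sf h36 Sigma SigmaHat hsub hne hprime hp TpH HatH hle cuspMeetsH).Cusp)
    (hx : (M.inertia y.1.1).map M.toTheta = M.DeltaTheta)
    {lpos : ℕ+} (hlpos : (lpos : ℕ) = l) (μ₁ : M.toThetaSetting.CyclotomeMod 1 lpos)
    (hIx : M.inertia y.1.1 ≤ M.GtpXu l) :
    ¬ (((StableCurveTemperedData.ofSpecialFibre (M.toTemperedCurve.ofOpenSubgroup (M.GtpXu l) (M.toThetaSetting.isOpen_GtpXu l) M.K (range_aug_GtpXu_eq_GK C) hDopen) d Sf h36 Sigma SigmaHat hsub hne hprime hp TpH HatH hle cuspMeetsH).inertiaTp y).map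
        (StableCurveTemperedData.ofSpecialFibre (M.toTemperedCurve.ofOpenSubgroup (M.GtpXu l) (M.toThetaSetting.isOpen_GtpXu l) M.K (range_aug_GtpXu_eq_GK C) hDopen) d Sf h36 Sigma SigmaHat hsub hne hprime hp TpH HatH hle cuspMeetsH).DeltaTp.subtype).comap
        T.plainIso.toMulEquiv.toMonoidHom ≤ T.incl.range := by
  intro hle'
  set g : M.PiTemp := M.toTemperedCurve.repOfOpen (M.GtpXu l) y.1 with hg
  apply C.not_map_conj_inertia_le_Huu y.1.1 hx g hlpos μ₁ hl.one_lt
  rintro _ ⟨i, hi, rfl⟩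
  -- `k := g i g⁻¹ ∈ Π^tp_{X̲}` (normal) and `k ∈ I_y`
  have hiU : i ∈ M.GtpXu l := hIx hi
  have hk : (MulAut.conj g).toMonoidHom i ∈ M.GtpXu l := (ThetaSetting.GtpXu_normal M.toThetaSetting l).conj_mem i hiU g
  have hiD : i ∈ M.decomp y.1.1 := (Subgroup.mem_inf.mp hi).1
  have hiΔ : M.aug i = 1 := (Subgroup.mem_inf.mp hi).2
  set k : ↥(M.GtpXu l) := ⟨(MulAut.conj g).toMonoidHom i, hk⟩ with hkdef
  have hkI : k ∈ ((StableCurveTemperedData.ofSpecialFibre (M.toTemperedCurve.ofOpenSubgroup (M.GtpXu l) (M.toThetaSetting.isOpen_GtpXu l) M.K (range_aug_GtpXu_eq_GK C) hDopen) d Sf h36 Sigma SigmaHat hsub hne hprime hp TpH HatH hle cuspMeetsH).inertiaTp y).map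
      (StableCurveTemperedData.ofSpecialFibre (M.toTemperedCurve.ofOpenSubgroup (M.GtpXu l) (M.toThetaSetting.isOpen_GtpXu l) M.K (range_aug_GtpXu_eq_GK C) hDopen) d Sf h36 Sigma SigmaHat hsub hne hprime hp TpH HatH hle cuspMeetsH).DeltaTp.subtype := by
    have hkaug : (M.toTemperedCurve.ofOpenSubgroup (M.GtpXu l) (M.toThetaSetting.isOpen_GtpXu l) M.K (range_aug_GtpXu_eq_GK C) hDopen).aug k = 1 := by
      rw [TemperedCurve.ofOpenSubgroup_aug_apply]
      change M.aug (g * i * g⁻¹) = 1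
      rw [map_mul, map_mul, map_inv, hiΔ, mul_one, mul_inv_cancel]
    have hkker : (StableCurveTemperedData.ofSpecialFibre (M.toTemperedCurve.ofOpenSubgroup (M.GtpXu l) (M.toThetaSetting.isOpen_GtpXu l) M.K (range_aug_GtpXu_eq_GK C) hDopen) d Sf h36 Sigma SigmaHat hsub hne hprime hp TpH HatH hle cuspMeetsH).prTp k = 1 := by
      apply Subtype.ext
      exact hkaug
    refine ⟨⟨k, hkker⟩, ?_, rfl⟩
    rw [SetLike.mem_coe, StableCurveTemperedData.ofSpecialFibre_mem_inertiaTp]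
    refine Subgroup.mem_inf.mpr ⟨?_, hkaug⟩
    rw [TemperedCurve.ofOpenSubgroup_decomp]
    change g⁻¹ * (g * i * g⁻¹) * g⁻¹⁻¹ ∈ M.decomp y.1.1
    have : g⁻¹ * (g * i * g⁻¹) * g⁻¹⁻¹ = i := by group
    rw [this]; exact hiD
  -- pull back through `plainIso`: `plainIso⁻¹ k ∈ incl Π_v`, hence `k ∈ inclPlain(Π_v) = Π^tp_{X̲̲}`
  have h1 : T.plainIso.toMulEquiv.symm k ∈ T.incl.range := by
    apply hle'
    rw [Subgroup.mem_comap, MulEquiv.coe_toMonoidHom, MulEquiv.apply_symm_apply]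
    exact hkI
  have h2 : k ∈ T.incl.range.map T.plainIso.toMulEquiv.toMonoidHom :=
    ⟨_, h1, by rw [MulEquiv.coe_toMonoidHom, MulEquiv.apply_symm_apply]⟩
  rw [T.map_plainIso_range_incl, BadPlaceSetting.ofUnderline_range_inclPlain] at h2
  exact Subgroup.mem_subgroupOf.mp h2

/-- **IUTchII:Def2.3(i)** (kurims p.67) **«`Π^tp_{X̲_v,ℍ} ⊄ Π_v`» at the GENUINE datum**, for every sub-graph `ℍ` meeting a cusp `y` of `X̲_v` ([IUTchI] Cor 2.3 (vi) of the
datum, `Cor23vi`, BY NAME): `plainIso⁻¹ Π^tp_{X̲_v,ℍ} ⊄ incl Π_v` — the `hnot` input of p439385's `def23_i_indices_ofUnderline_of_comap` — from the [EtTh]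
clause `hx` at the underlying cusp of `X`, a cyclotome `μ₁`, `I_x ⊆ Π^tp_{X̲}`, and `Π_v ⊴ Π^±_v` (`hN`).  PROVED (`not_comap_piTpXH_le_of_ramified_cusp` ∘
`not_comap_inertiaTp_le_range_incl_ofUnderline`). [claim: Mochizuki2012, status: disputed] -/
theorem not_comap_piTpXH_le_range_incl_ofUnderline [(M.GtpXu l).FiniteIndex] [FiniteDimensional ℚ_[p] M.K]
    (hN : (C.Huu.subgroupOf (M.GtpXu l)).Normal)
    (hDopen : ∀ (x : M.toTemperedCurve.Pt) (g : M.toTemperedCurve.PiTemp),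
      IsOpen (M.toTemperedCurve.aug '' ((M.toTemperedCurve.decompOfOpenAt (M.GtpXu l) x g).map (M.GtpXu l).subtype :
        Set M.toTemperedCurve.PiTemp)))
    (d : (M.toTemperedCurve.ofOpenSubgroup (M.GtpXu l) (M.toThetaSetting.isOpen_GtpXu l) M.K (range_aug_GtpXu_eq_GK C) hDopen).GroupLevelData)
    (Sf : SpecialFibreData ((M.toTemperedCurve.ofOpenSubgroup (M.GtpXu l) (M.toThetaSetting.isOpen_GtpXu l) M.K (range_aug_GtpXu_eq_GK C) hDopen).toTemperedArithmeticGroup d))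
    (h36 : Sf.Gc.Prop36Hypotheses) (Sigma SigmaHat : Set ℕ) (hsub : Sigma ⊆ SigmaHat) (hne : Sigma.Nonempty)
    (hprime : ∀ q ∈ SigmaHat, q.Prime) (hp : p ∉ Sigma) (TpH : Subgroup Sf.chart.G)
    (HatH : Subgroup (TemperedGraphGroupData.exists_completion_of_prop36 Sf.Gc h36 Sf.chart).choose)
    (hle : TpH.map (TemperedGraphGroupData.exists_completion_of_prop36 Sf.Gc h36 Sf.chart).choose_spec.choose.toMonoidHom ≤ HatH)
    (cuspMeetsH : {x : (M.toTemperedCurve.ofOpenSubgroup (M.GtpXu l) (M.toThetaSetting.isOpen_GtpXu l) M.K (range_aug_GtpXu_eq_GK C) hDopen).Pt // (M.toTemperedCurve.ofOpenSubgroup (M.GtpXu l) (M.toThetaSetting.isOpen_GtpXu l) M.K (range_aug_GtpXu_eq_GK C) hDopen).IsCusp x} → Prop)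
    (h23vi : (StableCurveTemperedData.ofSpecialFibre (M.toTemperedCurve.ofOpenSubgroup (M.GtpXu l) (M.toThetaSetting.isOpen_GtpXu l) M.K (range_aug_GtpXu_eq_GK C) hDopen) d Sf h36 Sigma SigmaHat hsub hne hprime hp TpH HatH hle cuspMeetsH).Cor23vi) (y : (StableCurveTemperedData.ofSpecialFibre (M.toTemperedCurve.ofOpenSubgroup (M.GtpXu l) (M.toThetaSetting.isOpen_GtpXu l) M.K (range_aug_GtpXu_eq_GK C) hDopen) d Sf h36 Sigma SigmaHat hsub hne hprime hp TpH HatH hle cuspMeetsH).Cusp) (hy : (StableCurveTemperedData.ofSpecialFibre (M.toTemperedCurve.ofOpenSubgroup (M.GtpXu l) (M.toThetaSetting.isOpen_GtpXu l) M.K (range_aug_GtpXu_eq_GK C) hDopen) d Sf h36 Sigma SigmaHat hsub hne hprime hp TpH HatH hle cuspMeetsH).cuspMeetsH y)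
    (hx : (M.inertia y.1.1).map M.toTheta = M.DeltaTheta)
    {lpos : ℕ+} (hlpos : (lpos : ℕ) = l) (μ₁ : M.toThetaSetting.CyclotomeMod 1 lpos)
    (hIx : M.inertia y.1.1 ≤ M.GtpXu l) :
    ¬ (StableCurveTemperedData.ofSpecialFibre (M.toTemperedCurve.ofOpenSubgroup (M.GtpXu l) (M.toThetaSetting.isOpen_GtpXu l) M.K (range_aug_GtpXu_eq_GK C) hDopen) d Sf h36 Sigma SigmaHat hsub hne hprime hp TpH HatH hle cuspMeetsH).piTpXH.comap T.plainIso.toMulEquiv.toMonoidHom ≤ T.incl.range := by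
  have hN' : T.incl.range.Normal := by
    refine T.range_incl_normal ?_
    rw [BadPlaceSetting.ofUnderline_range_inclPlain]
    exact hN
  exact StableCurveAgreement.not_comap_piTpXH_le_of_ramified_cusp (T := T)
    (D := (StableCurveTemperedData.ofSpecialFibre (M.toTemperedCurve.ofOpenSubgroup (M.GtpXu l) (M.toThetaSetting.isOpen_GtpXu l) M.K (range_aug_GtpXu_eq_GK C) hDopen) d Sf h36 Sigma SigmaHat hsub hne hprime hp TpH HatH hle cuspMeetsH))
    T.plainIso.toMulEquiv hN' h23vi y hy
    (not_comap_inertiaTp_le_range_incl_ofUnderline C μ hC hS hl hp2 hpl hζ hη T hDopen d Sf h36 Sigma SigmaHat hsub hne hprime hp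
      TpH HatH hle cuspMeetsH y hx hlpos μ₁ hIx)

/-- **IUTchII:Def2.3(i)** (kurims p.67) **abc-iut-L6-t1's `Def23_i_indices Dec W` AT THE GENUINE SETTING from [EtTh]/[IUTchI]-level inputs ALONE** (no inline ramification
hypothesis): over `BadPlaceSetting.ofUnderline`, for EVERY tower `W` and every `Dec` whose `Π_{v▶}`, `Π_{v•}` are the decomposition subgroups cut out (through
abc-iut-L6-t19's `plainIso`) by two of abc-iut-L5's data `ofSpecialFibre` of `X̲_v` (sub-graphs `Γ▶`, `Γ•`: `TpHtri`, `TpHbul` — identifications `htri`, `hbul`,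
the MERGE identification, explicit), MODULO per sub-graph: `Cor23Hyp`, [IUTchI] Cor 2.3 (iv), (vi) of the datum, a cusp `y` meeting it with the [EtTh] clause
`hx : toTheta(I_x) = Δ_Θ` ([EtTh] §2 p. 35; ⟸ commutator axis, abc-iut-w5-d165) and `I_x ⊆ Π^tp_{X̲}` (⟸ (P3)); plus ONE cyclotome `μ₁ : CyclotomeMod 1 l` and the tower's
`hN`.  All three printed clauses «`Π^±_{v□} ∩ Π_v = Π_{v□}`», «`Π^±_{v□}/Π_{v□} ≅ ℤ/lℤ`», «`Π^±_v/Π_v ≅ ℤ/lℤ`» for `□ ∈ {•, ▶}`.  PROVED.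
[claim: Mochizuki2012, status: disputed] -/
theorem def23_i_indices_ofUnderline_of_cusps [(M.GtpXu l).FiniteIndex] [FiniteDimensional ℚ_[p] M.K]
    (hN : (C.Huu.subgroupOf (M.GtpXu l)).Normal)
    (hDopen : ∀ (x : M.toTemperedCurve.Pt) (g : M.toTemperedCurve.PiTemp),
      IsOpen (M.toTemperedCurve.aug '' ((M.toTemperedCurve.decompOfOpenAt (M.GtpXu l) x g).map (M.GtpXu l).subtype :
        Set M.toTemperedCurve.PiTemp)))
    (d : (M.toTemperedCurve.ofOpenSubgroup (M.GtpXu l) (M.toThetaSetting.isOpen_GtpXu l) M.K (range_aug_GtpXu_eq_GK C) hDopen).GroupLevelData)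
    (Sf : SpecialFibreData ((M.toTemperedCurve.ofOpenSubgroup (M.GtpXu l) (M.toThetaSetting.isOpen_GtpXu l) M.K (range_aug_GtpXu_eq_GK C) hDopen).toTemperedArithmeticGroup d))
    (h36 : Sf.Gc.Prop36Hypotheses) (Sigma SigmaHat : Set ℕ) (hsub : Sigma ⊆ SigmaHat) (hne : Sigma.Nonempty)
    (hprime : ∀ q ∈ SigmaHat, q.Prime) (hp : p ∉ Sigma)
    (TpHtri TpHbul : Subgroup Sf.chart.G)
    (HatHtri HatHbul : Subgroup (TemperedGraphGroupData.exists_completion_of_prop36 Sf.Gc h36 Sf.chart).choose)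
    (hletri : TpHtri.map (TemperedGraphGroupData.exists_completion_of_prop36 Sf.Gc h36 Sf.chart).choose_spec.choose.toMonoidHom ≤ HatHtri)
    (hlebul : TpHbul.map (TemperedGraphGroupData.exists_completion_of_prop36 Sf.Gc h36 Sf.chart).choose_spec.choose.toMonoidHom ≤ HatHbul)
    (cMHtri cMHbul : {x : (M.toTemperedCurve.ofOpenSubgroup (M.GtpXu l) (M.toThetaSetting.isOpen_GtpXu l) M.K (range_aug_GtpXu_eq_GK C) hDopen).Pt // (M.toTemperedCurve.ofOpenSubgroup (M.GtpXu l) (M.toThetaSetting.isOpen_GtpXu l) M.K (range_aug_GtpXu_eq_GK C) hDopen).IsCusp x} → Prop)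
    {E' : HodgeArakelov.EtaleThetaData (BadPlaceSetting.ofUnderline C μ hC hS hl hp2 hpl hζ hη).toThetaSetting P}
    (Dec : SubgraphDecomposition (BadPlaceSetting.ofUnderline C μ hC hS hl hp2 hpl hζ hη) T E') (W : PlusMinusTower T)
    (htri : Dec.Ptri = ((StableCurveTemperedData.ofSpecialFibre (M.toTemperedCurve.ofOpenSubgroup (M.GtpXu l) (M.toThetaSetting.isOpen_GtpXu l) M.K (range_aug_GtpXu_eq_GK C) hDopen) d Sf h36 Sigma SigmaHat hsub hne hprime hp TpHtri HatHtri hletri cMHtri).piTpXH.comap T.plainIso.toMulEquiv.toMonoidHom).comap T.incl)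
    (hbul : Dec.Pbullet = ((StableCurveTemperedData.ofSpecialFibre (M.toTemperedCurve.ofOpenSubgroup (M.GtpXu l) (M.toThetaSetting.isOpen_GtpXu l) M.K (range_aug_GtpXu_eq_GK C) hDopen) d Sf h36 Sigma SigmaHat hsub hne hprime hp TpHbul HatHbul hlebul cMHbul).piTpXH.comap T.plainIso.toMulEquiv.toMonoidHom).comap T.incl)
    {lpos : ℕ+} (hlpos : (lpos : ℕ) = l) (μ₁ : M.toThetaSetting.CyclotomeMod 1 lpos)
    (hHyptri : (StableCurveTemperedData.ofSpecialFibre (M.toTemperedCurve.ofOpenSubgroup (M.GtpXu l) (M.toThetaSetting.isOpen_GtpXu l) M.K (range_aug_GtpXu_eq_GK C) hDopen) d Sf h36 Sigma SigmaHat hsub hne hprime hp TpHtri HatHtri hletri cMHtri).Cor23Hyp) (h23ivtri : (StableCurveTemperedData.ofSpecialFibre (M.toTemperedCurve.ofOpenSubgroup (M.GtpXu l) (M.toThetaSetting.isOpen_GtpXu l) M.K (range_aug_GtpXu_eq_GK C) hDopen) d Sf h36 Sigma SigmaHat hsub hne hprime hp TpHtri HatHtri hletri cMHtri).Cor23iv)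 (h23vitri : (StableCurveTemperedData.ofSpecialFibre (M.toTemperedCurve.ofOpenSubgroup (M.GtpXu l) (M.toThetaSetting.isOpen_GtpXu l) M.K (range_aug_GtpXu_eq_GK C) hDopen) d Sf h36 Sigma SigmaHat hsub hne hprime hp TpHtri HatHtri hletri cMHtri).Cor23vi)
    (ytri : (StableCurveTemperedData.ofSpecialFibre (M.toTemperedCurve.ofOpenSubgroup (M.GtpXu l) (M.toThetaSetting.isOpen_GtpXu l) M.K (range_aug_GtpXu_eq_GK C) hDopen) d Sf h36 Sigma SigmaHat hsub hne hprime hp TpHtri HatHtri hletri cMHtri).Cusp) (hytri : (StableCurveTemperedData.ofSpecialFibre (M.toTemperedCurve.ofOpenSubgroup (M.GtpXu l) (M.toThetaSetting.isOpen_GtpXu l) M.K (range_aug_GtpXu_eq_GK C) hDopen) d Sf h36 Sigma SigmaHat hsub hne hprime hp TpHtri HatHtri hletri cMHtri).cuspMeetsH ytri) (hxtri : (M.inertia ytri.1.1).map M.toTheta = M.DeltaTheta)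
    (hIxtri : M.inertia ytri.1.1 ≤ M.GtpXu l)
    (hHypbul : (StableCurveTemperedData.ofSpecialFibre (M.toTemperedCurve.ofOpenSubgroup (M.GtpXu l) (M.toThetaSetting.isOpen_GtpXu l) M.K (range_aug_GtpXu_eq_GK C) hDopen) d Sf h36 Sigma SigmaHat hsub hne hprime hp TpHbul HatHbul hlebul cMHbul).Cor23Hyp) (h23ivbul : (StableCurveTemperedData.ofSpecialFibre (M.toTemperedCurve.ofOpenSubgroup (M.GtpXu l) (M.toThetaSetting.isOpen_GtpXu l) M.K (range_aug_GtpXu_eq_GK C) hDopen) d Sf h36 Sigma SigmaHat hsub hne hprime hp TpHbul HatHbul hlebul cMHbul).Cor23iv) (h23vibul : (StableCurveTemperedData.ofSpecialFibre (M.toTemperedCurve.ofOpenSubgroup (M.GtpXu l) (M.toThetaSetting.isOpen_GtpXu l) M.K (range_aug_GtpXu_eq_GK C) hDopen) d Sf h36 Sigma SigmaHat hsub hne hprime hp TpHbul HatHbul hlebul cMHbul).Cor23vi)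
    (ybul : (StableCurveTemperedData.ofSpecialFibre (M.toTemperedCurve.ofOpenSubgroup (M.GtpXu l) (M.toThetaSetting.isOpen_GtpXu l) M.K (range_aug_GtpXu_eq_GK C) hDopen) d Sf h36 Sigma SigmaHat hsub hne hprime hp TpHbul HatHbul hlebul cMHbul).Cusp) (hybul : (StableCurveTemperedData.ofSpecialFibre (M.toTemperedCurve.ofOpenSubgroup (M.GtpXu l) (M.toThetaSetting.isOpen_GtpXu l) M.K (range_aug_GtpXu_eq_GK C) hDopen) d Sf h36 Sigma SigmaHat hsub hne hprime hp TpHbul HatHbul hlebul cMHbul).cuspMeetsH ybul) (hxbul : (M.inertia ybul.1.1).map M.toTheta = M.DeltaTheta)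
    (hIxbul : M.inertia ybul.1.1 ≤ M.GtpXu l) :
    Def23_i_indices Dec W :=
  def23_i_indices_ofUnderline_of_comap C μ hC hS hl hp2 hpl hζ hη hN (T := T)
    (Dtri := (StableCurveTemperedData.ofSpecialFibre (M.toTemperedCurve.ofOpenSubgroup (M.GtpXu l) (M.toThetaSetting.isOpen_GtpXu l) M.K (range_aug_GtpXu_eq_GK C) hDopen) d Sf h36 Sigma SigmaHat hsub hne hprime hp TpHtri HatHtri hletri cMHtri))
    (Dbul := (StableCurveTemperedData.ofSpecialFibre (M.toTemperedCurve.ofOpenSubgroup (M.GtpXu l) (M.toThetaSetting.isOpen_GtpXu l) M.K (range_aug_GtpXu_eq_GK C) hDopen) d Sf h36 Sigma SigmaHat hsub hne hprime hp TpHbul HatHbul hlebul cMHbul))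
    Dec W T.plainIso.toMulEquiv T.plainIso.toMulEquiv htri hbul
    hHyptri h23ivtri
    (not_comap_piTpXH_le_range_incl_ofUnderline C μ hC hS hl hp2 hpl hζ hη T hN hDopen d Sf h36 Sigma SigmaHat hsub hne hprime hp
      TpHtri HatHtri hletri cMHtri h23vitri ytri hytri hxtri (lpos := lpos) hlpos μ₁ hIxtri)
    hHypbul h23ivbul
    (not_comap_piTpXH_le_range_incl_ofUnderline C μ hC hS hl hp2 hpl hζ hη T hN hDopen d Sf h36 Sigma SigmaHat hsub hne hprime hp
      TpHbul HatHbul hlebul cMHbul h23vibul ybul hybul hxbul (lpos := lpos) hlpos μ₁ hIxbul)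

end PlusMinusTower

end Literature.IUT.HodgeArakelov

end
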